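import Summits.CriticalPhenomena.PercolationContinuityZ3.Theorems.PercNearOneGluingNoHeavyQuantClusterLawTV
import Summits.CriticalPhenomena.PercolationContinuityZ3.Theorems.PercNearOneGluingNoHeavyQuantRateAllCurrencies
import Summits.CriticalPhenomena.PercolationContinuityZ3.Theorems.PercNearOneGluingNoHeavyQuantCriticalProbLeHalf
import HarnessLib

/-!
# QUANT lane (p4 gen 22): THE EXPLICIT TOTAL-VARIATION MODULUS OF THE CLUSTER LAW AT `p_c(ℤ³)` —
# `sup_B |P_{p_c}(B) − P_p(B)| ≤ (1 − 2⁻¹⁹⁸⁶)^⌊(log*₂ s − 8)/2⌋ + 12·s·|p − p_c|` for every `s`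

builds on p205010 (kernel theorem, internal audit signed; external expert review pending) — through the lane's volume rate
`Quant.EpsSharp.volume_Z3_three_sharp` (`P_{p_c(ℤ³)}(|C(0)| ≥ s) ≤ (1 − 2⁻¹⁹⁸⁶)^⌊(log*₂ s − 8)/2⌋`, whose proof rests on p205010's
chain), combined with the p205010-free TV modulus of `…QuantClusterLawTV`
(`|P_p(B) − P_{p'}(B)| ≤ P_p(|C| ≥ n) + 2dn(p'−p)/(1−p)`, uniformly over cluster events `B = {C(0) ∈ 𝒜}`) and `p_c(ℤ³) ≤ 1/2`
(`Quant.criticalProbI_le_half`).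

* `abs_sub_le_linear_modulus_left'` — the linear modulus with the constants at the LARGER parameter (for `p' ≤ p`);
* **`abs_sub_criticalProbI_le_Z3`** — for every cluster event `B`, every `p ∈ [0,1]` and every `s`:
  `|P_{p_c(ℤ³)}(B) − P_p(B)| ≤ (1 − 2⁻¹⁹⁸⁶)^⌊(log*₂ s − 8)/2⌋ + 12·s·|p − p_c(ℤ³)|`.
  This is the (T2)-type statement of the lane for the WHOLE LAW of the critical cluster: an explicit modulus of continuity,
  of iterated-logarithm class in `|p − p_c|` after optimising `s` (e.g. `s = ⌊|p − p_c|^{-1/2}⌋`), nothing more.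

HONEST: explicit function tending to `0`; class log*; polynomial/power-law moduli OPEN (they would follow verbatim from a
power-law volume tail at `p_c` through `ClusterLaw.abs_sub_le_volume_modulus`).
-/

noncomputable section

namespace Summit.CriticalPhenomena.PercolationContinuityZ3.Theorems.ClusterLaw

open MeasureTheory Literature.Probability.Percolation Literature.Probability.LatticeModels
open scoped ENNReal Classical

variable {d : ℕ}

/-- `cl⁻¹ 𝒜`: the cluster event `{ω | C(0)(ω) ∈ 𝒜}`. -/
local notation3 "cl⁻¹" 𝒜:arg => (fun ω : BondConfig (Site d) => openCluster ω (0 : Site d)) ⁻¹' 𝒜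

/-- `cl3⁻¹ 𝒜`: the cluster event on `ℤ³`. -/
local notation3 "cl3⁻¹" 𝒜:arg => (fun ω : BondConfig (Site 3) => openCluster ω (0 : Site 3)) ⁻¹' 𝒜

/-- `aa p k = P_p(|C(0)| ≥ k)`. -/
local notation3 "aa" => fun (p : unitInterval) (k : ℕ) =>
  (bondPercolation (zdGraph d) p).real (clusterSizeGe (0 : Site d) k)

/-- **Linear modulus with constants at the larger parameter**: for `p' ≤ p < 1`, every cluster event `B` and every `n`,
`|P_p(B) − P_{p'}(B)| ≤ P_p(|C| ≥ n) + 2dn(p − p')/(1 − p)` (`a_n` is non-decreasing and `1/(1−p') ≤ 1/(1−p)`). -/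
theorem abs_sub_le_linear_modulus_left' (p p' : unitInterval) (hpp : p' ≤ p) (hp1 : (p : ℝ) < 1)
    {𝒜 : Set (Set (Site d))} (h𝒜 : MeasurableSet (cl⁻¹ 𝒜)) (n : ℕ) :
    |(bondPercolation (zdGraph d) p).real (cl⁻¹ 𝒜) - (bondPercolation (zdGraph d) p').real (cl⁻¹ 𝒜)| ≤
      aa p n + 2 * d * n * (((p : ℝ) - p') / (1 - p)) := by
  have hp'1 : (p' : ℝ) < 1 := lt_of_le_of_lt (show (p' : ℝ) ≤ p from hpp) hp1
  have h := abs_sub_le_linear_modulus p' p hpp hp'1 h𝒜 n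
  rw [abs_sub_comm] at h
  refine h.trans ?_
  have hc : ((p : ℝ) - p') / (1 - p') ≤ ((p : ℝ) - p') / (1 - p) :=
    div_le_div_of_nonneg_left (sub_nonneg.2 hpp) (by linarith) (by linarith [show (p' : ℝ) ≤ p from hpp])
  have hmono : aa p' n ≤ aa p n :=
    DCT16.real_mono_of_isUpperSet (zdGraph d)
      (fun _ _ hle hω => le_trans hω (Set.encard_le_encard (openCluster_mono hle (0 : Site d))))
      (measurableSet_clusterSizeGe 0 n) hpp
  gcongr

/-- **Two-sided linear modulus at a base point `q < 1`**: for every `p`, every cluster event and every `n`,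
`|P_q(B) − P_p(B)| ≤ P_{q ⊔ p}(|C| ≥ n) + 2dn|p − q|/(1 − (q ⊔ p))`; here in the weaker but convenient form with the volume
term at `q` when `p ≤ q` and at `q` ... precisely: `|P_q(B) − P_p(B)| ≤ max(a_n(q), a_n(p)) + 2dn|p−q|/(1 − max(q,p))`. We
record the case split used below: `p ≤ q` gives `a_n(q) + 2dn(q−p)/(1−q)`. -/
theorem abs_sub_le_of_le (q p : unitInterval) (hpq : p ≤ q) (hq1 : (q : ℝ) < 1)
    {𝒜 : Set (Set (Site d))} (h𝒜 : MeasurableSet (cl⁻¹ 𝒜)) (n : ℕ) :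
    |(bondPercolation (zdGraph d) q).real (cl⁻¹ 𝒜) - (bondPercolation (zdGraph d) p).real (cl⁻¹ 𝒜)| ≤
      aa q n + 2 * d * n * (|(p : ℝ) - q| / (1 - q)) := by
  have h := abs_sub_le_linear_modulus_left' q p hpq hq1 h𝒜 n
  rwa [show (q : ℝ) - p = |(p : ℝ) - q| by
    rw [abs_sub_comm, abs_of_nonneg (sub_nonneg.2 (show (p : ℝ) ≤ q from hpq))]] at h

/-- The case `q ≤ p`: `|P_q(B) − P_p(B)| ≤ a_n(q) + 2dn(p−q)/(1−q)`. -/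
theorem abs_sub_le_of_ge (q p : unitInterval) (hqp : q ≤ p) (hq1 : (q : ℝ) < 1)
    {𝒜 : Set (Set (Site d))} (h𝒜 : MeasurableSet (cl⁻¹ 𝒜)) (n : ℕ) :
    |(bondPercolation (zdGraph d) q).real (cl⁻¹ 𝒜) - (bondPercolation (zdGraph d) p).real (cl⁻¹ 𝒜)| ≤
      aa q n + 2 * d * n * (|(p : ℝ) - q| / (1 - q)) := by
  have h := abs_sub_le_linear_modulus q p hqp hq1 h𝒜 n
  rwa [show (p : ℝ) - q = |(p : ℝ) - q| by rw [abs_of_nonneg (sub_nonneg.2 (show (q : ℝ) ≤ p from hqp))]] at h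

/-- **Two-sided linear modulus**: for `q < 1`, every `p`, every cluster event `B` and every `n`,
`|P_q(B) − P_p(B)| ≤ P_q(|C| ≥ n) + 2dn|p − q|/(1 − q)`. -/
theorem abs_sub_le_two_sided (q p : unitInterval) (hq1 : (q : ℝ) < 1)
    {𝒜 : Set (Set (Site d))} (h𝒜 : MeasurableSet (cl⁻¹ 𝒜)) (n : ℕ) :
    |(bondPercolation (zdGraph d) q).real (cl⁻¹ 𝒜) - (bondPercolation (zdGraph d) p).real (cl⁻¹ 𝒜)| ≤
      aa q n + 2 * d * n * (|(p : ℝ) - q| / (1 - q)) := by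
  rcases le_total p q with h | h
  · exact abs_sub_le_of_le q p h hq1 h𝒜 n
  · exact abs_sub_le_of_ge q p h hq1 h𝒜 n

/-- **THE EXPLICIT TOTAL-VARIATION MODULUS OF THE LAW OF THE CRITICAL CLUSTER ON `ℤ³`**: for every cluster event
`B = {C(0) ∈ 𝒜}`, every `p ∈ [0,1]` and every `s ∈ ℕ`,
`|P_{p_c(ℤ³)}(B) − P_p(B)| ≤ (1 − 2⁻¹⁹⁸⁶)^⌊(log*₂ s − 8)/2⌋ + 12·s·|p − p_c(ℤ³)|`
(volume rate at `p_c` of class log* — builds on p205010 — plus the coupling modulus with `2d = 6`, `1 − p_c ≥ 1/2`).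
The right side tends to `0` as `p → p_c` after choosing `s = s(p) → ∞` slowly: an explicit modulus of continuity, in total
variation, of `p ↦ Law_p(C(0))` at the critical point of `ℤ³`. -/
theorem abs_sub_criticalProbI_le_Z3 {𝒜 : Set (Set (Site 3))} (h𝒜 : MeasurableSet (cl3⁻¹ 𝒜)) (p : unitInterval) (s : ℕ) :
    |(bondPercolation (zdGraph 3) (criticalProbI 3)).real (cl3⁻¹ 𝒜) - (bondPercolation (zdGraph 3) p).real (cl3⁻¹ 𝒜)| ≤
      (1 - (1 / 2 : ℝ) ^ 1986) ^ ((Quant.logStar 2 s - 8) / 2) + 12 * s * |(p : ℝ) - criticalProbI 3| := by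
  have hhalf : (criticalProbI 3 : ℝ) ≤ 1 / 2 := Quant.criticalProbI_le_half (d := 3) (by norm_num)
  have hq1 : (criticalProbI 3 : ℝ) < 1 := by linarith
  have h := abs_sub_le_two_sided (d := 3) (criticalProbI 3) p hq1 h𝒜 s
  have hvol := Quant.EpsSharp.volume_Z3_three_sharp s
  have habs : 0 ≤ |(p : ℝ) - criticalProbI 3| := abs_nonneg _
  have hfrac : |(p : ℝ) - criticalProbI 3| / (1 - criticalProbI 3) ≤ 2 * |(p : ℝ) - criticalProbI 3| := by
    rw [div_le_iff₀ (by linarith)]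
    nlinarith
  calc |(bondPercolation (zdGraph 3) (criticalProbI 3)).real (cl3⁻¹ 𝒜) - (bondPercolation (zdGraph 3) p).real (cl3⁻¹ 𝒜)|
      ≤ (bondPercolation (zdGraph 3) (criticalProbI 3)).real (clusterSizeGe (0 : Site 3) s) +
          2 * (3 : ℕ) * s * (|(p : ℝ) - criticalProbI 3| / (1 - criticalProbI 3)) := h
    _ ≤ (1 - (1 / 2 : ℝ) ^ 1986) ^ ((Quant.logStar 2 s - 8) / 2) + 2 * (3 : ℕ) * s * (2 * |(p : ℝ) - criticalProbI 3|) := by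
        gcongr
    _ = _ := by
        congr 1
        push_cast
        ring

end Summit.CriticalPhenomena.PercolationContinuityZ3.Theorems.ClusterLaw
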